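import Summits.RiemannHypothesis.RiemannHypothesis.Theses.SpectralTrace
import Summits.RiemannHypothesis.RiemannHypothesis.Theorems.WeilWindowFlowGronwallLeakageStrictAnti
import Literature.NumberTheory.LFunctions.WeilFirstPrimePositivityC
import Literature.NumberTheory.LFunctions.WeilGroundState
import Literature.NumberTheory.LFunctions.WeilGroundEnergyProofs
import Literature.NumberTheory.LFunctions.WeilWindowSuzukiContinuityProofs
import HarnessLib

/-!
# Yoshida's first rung is strictly regular: `0 < ε((log 3)/2)`

Crux `stmt-RiemannHypothesis-14659` (`SpectralTrace.WindowStep`), line `conjugate-point`: the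
skeleton's by-product `windowTracePrime2_of_crystRegular` and the edge child `NoDegenerateEdge` both
meet the question whether the certified rung `a = (log 3)/2` (`weilPositivityOn_log_three_half`, i.e.
`0 ≤ ε((log 3)/2)`) could itself be a CONJUGATE POINT (`ε((log 3)/2) = 0`). It cannot:
`weilGroundEnergy_log_three_half_pos : 0 < ε((log 3)/2)` (`ε = weilGroundEnergy`), unconditional.

Proof (the margin the Stage-C certificate happens to carry; the pattern of
`strictArchimedeanBottom_proof` for `ε((log 2)/2)`, one rung up). The kernel-checked certificate
`weilCert3C` (`check_weilCert3C`, support `b = 563/1024 ≥ (log 3)/2`) proves `E₂(g) ≥ 0` on `C(b)`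
through `WeilCert3.weilFirstPrimeQuadratic_nonneg_of_check`, which bounds the term `−(log π)‖g‖₂²` of
`E₂` by the rational `logPiHi20 ≥ log π`; every other step is an inequality between the remaining
quantities. Since `log π < logPiHi20` STRICTLY (`π < piHi20`), replaying the soundness proof with the
exact `log π` kept aside gives `(logPiHi20 − log π)‖g‖₂² ≤ E₂(g)` on `C(b) ⊇ C((log 3)/2)`, where
`E₂ = Re Q` (`weilQuadratic_re_eq_weilFirstPrimeQuadratic`); so `ε((log 3)/2) ≥ logPiHi20 − log π > 0`
(`le_csInf`, the sphere is nonempty by `exists_isWeilTest_sphere`). Numerically `ε((log 3)/2) ≈ 6·10⁻⁸`.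

Consequences: `0 < ε(a)` for `0 < a ≤ (log 3)/2`; a conjugate point has `a⋆ > (log 3)/2`;
**`∃ a > (log 3)/2, WeilPositivityOn a`** — Weil positivity on a window with the primes `2` AND `3`
inside (continuity of `ε`; the analogue of `primeTwoWindow_proof` one rung up; ineffective); and for
the line, `CrystRegular → WindowTraceArch → WindowTracePrime2` with no side condition.

Axioms ⊆ {propext, Classical.choice, Quot.sound}.
-/

set_option linter.dupNamespace false

noncomputable section

open Complex Finset MeasureTheory Set Filter
open scoped Real Topology ComplexConjugate BigOperators

namespace Summit.RiemannHypothesis.RiemannHypothesis.Theorems.SpectralTraceWindowStep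

open Literature.NumberTheory.LFunctions
open Literature.Analysis.ValidatedNumerics.Numerics
open Literature.Analysis.SpecialFunctions
open Summit.RiemannHypothesis.RiemannHypothesis.Theses.SpectralTrace
open Summit.RiemannHypothesis.RiemannHypothesis.Theorems.WeilWindowFlowGronwallLeakage

/-! ## The margin form of the Stage-C soundness theorem -/

set_option maxHeartbeats 1600000 in
/-- **Margin version of `WeilCert3.weilFirstPrimeQuadratic_nonneg_of_check`.** If `c.check = true`
then for every test function `g` with `tsupport g ⊆ [-b, b]`,
`(logPiHi20 − log π) ‖g‖₂² ≤ E₂(g)`. The proof is the soundness proof of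
`WeilFirstPrimeCertificateZ.lean` verbatim, except that its one use of `log π ≤ logPiHi20` is not
spent: the reduction bounds `E₂(g) + (log π − logPiHi20)‖g‖₂²` below by the certified
non-negative core. [folklore] -/
theorem weilFirstPrimeQuadratic_margin_of_check {c : WeilCert3} (h : c.check = true) {g : ℝ → ℂ}
    (hg : IsWeilTest g) (hsupp : tsupport g ⊆ Icc (-(c.b : ℝ)) c.b) :
    (((logPiHi20 : ℚ) : ℝ) - Real.log π) * weilNorm2Sq g ≤ weilFirstPrimeQuadratic g := by
  unfold weilFirstPrimeQuadratic weilFirstPrimeWeight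
  obtain ⟨hcells3, hsc, hnuchk, hb0, hb1⟩ := WeilCert3.check_spec h
  have hcells : CellsOK c.base.wL c.base.T c.cells := cellsOK_of_checkCells₃ hcells3
  obtain ⟨-, hbpos, hba, ha1q, hT, haT, hρT, hN, hκ⟩ := WeilCert3.scalars_spec hsc
  set a : ℝ := (c.base.a0 : ℝ) with ha_def
  have hba' : ((c.b : ℚ) : ℝ) ≤ a := by rw [ha_def]; exact_mod_cast hba
  have hb0' : (0 : ℝ) < c.b := by exact_mod_cast hbpos
  have ha : 0 < a := by linarith
  have ha1 : a ≤ 1 := by rw [ha_def]; exact_mod_cast ha1q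
  have hsupp' : tsupport g ⊆ Icc (-a) a := hsupp.trans (Icc_subset_Icc (by linarith) hba')
  set n := c.base.N + 1 with hn
  set nu := c.nuTab with hnu
  set M : ℕ → ℂ := weilMoment a g with hM
  set L := weilNorm1 g with hL
  set N2 := weilNorm2Sq g with hN2
  set z : ℕ → ℕ → ℝ := fun k l ↦ (conj (M k) * M l).re with hz
  have hzsym : ∀ k l, z k l = z l k := fun k l ↦ by
    rw [hz]; simp only; rw [← WeilAna.re_mul_conj_eq, mul_comm]
  have hL0 : 0 ≤ L := weilNorm1_nonneg g
  have hN20 : 0 ≤ N2 := weilNorm2Sq_nonneg g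
  have hL1 : L ^ 2 ≤ 2 * a * N2 := weilNorm1_sq_le hg ha hsupp'
  -- the three terms of E(g)
  set P : ℝ := 2 * (weilMellin g 0 * conj (weilMellin g 1)).re with hP
  set A : ℝ := ∫ t : ℝ, ‖weilMellin g (1 / 2 + t * I)‖ ^ 2 *
    (Literature.Analysis.SpecialFunctions.reDigammaQuarter t -
      Real.sqrt 2 * Real.log 2 * Real.cos (t * Real.log 2)) with hA
  set Γ : ℝ := ∫ t : ℝ, ‖weilMellin g (1 / 2 + t * I)‖ ^ 2 * cellsGamma₂ c.base.wL c.cells t with hΓ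
  -- Step A
  set ρ : ℝ := 2 * (a / 2) ^ (c.base.N + 1) / (c.base.N + 1).factorial with hρ
  have hρ0 : 0 ≤ ρ := by positivity
  have hPA : ∑ k ∈ range n, ∑ l ∈ range n,
      (2 * ((-a / 2) ^ k / k.factorial) * ((a / 2) ^ l / l.factorial)) * z k l -
      (8 * ρ + 6 * ρ ^ 2) * L ^ 2 ≤ P := WeilAna.polar_lower_bound hg ha ha1 hsupp' c.base.N
  rw [WeilCert.polar_symmetrize n a z hzsym] at hPA
  -- Step B
  have hB : (c.base.wL : ℝ) * (2 * π * N2) - Γ ≤ A := WeilCert3.arch_lower_bound hcells hg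
  -- Step C
  have hC : Γ ≤ ∑ k ∈ range n, ∑ l ∈ range n, WeilCert3.gHat c k l * z k l +
      5 * L ^ 2 * (c.nuPrimeAbs : ℝ) := by
    have := WeilCert3.freq_integral_bound hcells hsc hg (by rwa [← ha_def])
    rw [← ha_def] at this
    exact this
  -- constants
  set q : ℝ := ((invTwoPiHi20 : ℚ) : ℝ) with hq
  set qLo : ℝ := ((invTwoPiLo20 : ℚ) : ℝ) with hqLo
  have hq1 : 1 / (2 * π) ≤ q := invTwoPiHi20_ge
  have hq0 : 0 ≤ q := invTwoPiHi20_nonneg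
  have hqLo1 : qLo ≤ 1 / (2 * π) := invTwoPiLo20_le
  have hν0 : 0 ≤ ((c.nuPrimeAbs : ℚ) : ℝ) := by
    unfold WeilCert3.nuPrimeAbs
    have h1 : (0 : ℝ) ≤ (cellsAbsMomentQ c.base.wL c.cells (c.base.N + 1) : ℝ) := by
      rw [← (integral_stepAux_mul_powV (wL := c.base.wL) hcells.valid (c.base.N + 1)).2]
      refine integral_nonneg fun s' ↦ mul_nonneg ((stepAux_propsV (wL := c.base.wL)
        hcells.valid).1.choose_spec s').1 ?_
      have hev : Even (c.base.N + 1) := ⟨c.base.nb, by omega⟩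
      rw [← hev.pow_abs]; positivity
    push_cast
    have ha0 : (0 : ℝ) ≤ (c.base.a0 : ℝ) := by rw [← ha_def]; exact ha.le
    positivity
  have hpi : 0 < 1 / (2 * π) := by positivity
  -- the signed `Γ`: `−(1/2π)Γ ≥ −qX − (q − qLo)·C₀·7·N2`
  set C₀ : ℝ := ((cellsBndMaxQ c.base.wL c.cells : ℚ) : ℝ) with hC₀
  have hC₀0 : 0 ≤ C₀ := by rw [hC₀]; exact_mod_cast cellsBndMaxQ_nonneg c.base.wL c.cells
  have hγabs : ∀ t, |cellsGamma₂ c.base.wL c.cells t| ≤ C₀ := fun t ↦ by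
    rw [hC₀]; exact abs_cellsGamma₂_le_bndMax hcells t
  set ind : ℝ → ℝ := Set.indicator (Icc (-(c.base.T : ℝ)) c.base.T) (fun _ ↦ (1 : ℝ)) with hind
  have hind01 : ∀ t, 0 ≤ ind t ∧ ind t ≤ 1 := fun t ↦ by
    rw [hind]; by_cases ht : t ∈ Icc (-(c.base.T : ℝ)) c.base.T
    · rw [Set.indicator_of_mem ht]; norm_num
    · rw [Set.indicator_of_notMem ht]; norm_num
  have hindm : Measurable ind := by rw [hind]; exact measurable_const.indicator measurableSet_Icc
  set PiT : ℝ := ∫ t : ℝ, ‖weilMellin g (1 / 2 + t * I)‖ ^ 2 * ind t with hPiT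
  have hiPiT : Integrable fun t : ℝ ↦ ‖weilMellin g (1 / 2 + t * I)‖ ^ 2 * ind t :=
    integrable_norm_sq_weilMellin_mul hg hindm (A := 1) (B := 0) zero_le_one le_rfl fun t ↦ by
      rw [zero_mul, add_zero, abs_of_nonneg (hind01 t).1]; exact (hind01 t).2
  obtain ⟨BΓ, hBΓ0, hBΓ⟩ := exists_abs_cellsGamma₂_le c.base.wL c.cells
  have hiΓ : Integrable fun t : ℝ ↦
      ‖weilMellin g (1 / 2 + t * I)‖ ^ 2 * cellsGamma₂ c.base.wL c.cells t :=
    integrable_norm_sq_weilMellin_mul hg (measurable_cellsGamma₂ _ _) hBΓ0 le_rfl (B := 0)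
      (fun t ↦ by simpa using hBΓ t)
  have hPiT0 : 0 ≤ PiT := integral_nonneg fun t ↦ mul_nonneg (sq_nonneg _) (hind01 t).1
  have hPiTle : PiT ≤ 7 * N2 := by
    have h1 : PiT ≤ ∫ t : ℝ, ‖weilMellin g (1 / 2 + t * I)‖ ^ 2 :=
      integral_mono hiPiT (integrable_norm_sq_weilMellin_half_line hg) fun t ↦ by
        simpa using mul_le_mul_of_nonneg_left (hind01 t).2 (sq_nonneg ‖weilMellin g (1 / 2 + t * I)‖)
    rw [integral_norm_sq_weilMellin_half_line hg] at h1
    have h7 : 2 * π ≤ 7 := by linarith [Real.pi_lt_d2]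
    nlinarith
  -- `Γ₊ = Γ + C₀ PiT ≥ 0`
  have hΓplus : 0 ≤ Γ + C₀ * PiT := by
    rw [hΓ, hPiT, ← integral_const_mul, ← integral_add hiΓ (hiPiT.const_mul _)]
    refine integral_nonneg fun t ↦ ?_
    rw [show ‖weilMellin g (1 / 2 + t * I)‖ ^ 2 * cellsGamma₂ c.base.wL c.cells t +
        C₀ * (‖weilMellin g (1 / 2 + t * I)‖ ^ 2 * ind t) =
        ‖weilMellin g (1 / 2 + t * I)‖ ^ 2 * (cellsGamma₂ c.base.wL c.cells t + C₀ * ind t) by ring]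
    refine mul_nonneg (sq_nonneg _) ?_
    by_cases ht : t ∈ Icc (-(c.base.T : ℝ)) c.base.T
    · have : ind t = 1 := by rw [hind, Set.indicator_of_mem ht]
      rw [this, mul_one]
      linarith [neg_abs_le (cellsGamma₂ c.base.wL c.cells t), hγabs t]
    · have : ind t = 0 := by rw [hind, Set.indicator_of_notMem ht]
      have hT' : (c.base.T : ℝ) ≤ |t| := by
        rw [Set.mem_Icc, not_and_or, not_le, not_le] at ht
        rcases ht with ht | ht
        · linarith [neg_abs_le t, le_abs_self t, neg_le_abs t]
        · exact ht.le.trans (le_abs_self t)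
      rw [this, mul_zero, add_zero, cellsGamma₂_eq_zeroV hcells hT']
  have hΓlow : -(q * (∑ k ∈ range n, ∑ l ∈ range n, WeilCert3.gHat c k l * z k l +
      5 * L ^ 2 * (c.nuPrimeAbs : ℝ))) - (q - qLo) * C₀ * (7 * N2) ≤ -(1 / (2 * π) * Γ) := by
    have e : -(1 / (2 * π) * Γ) = -(1 / (2 * π)) * (Γ + C₀ * PiT) + 1 / (2 * π) * (C₀ * PiT) := by
      ring
    rw [e]
    have h1 : -q * (Γ + C₀ * PiT) ≤ -(1 / (2 * π)) * (Γ + C₀ * PiT) := by nlinarith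
    have h2 : qLo * (C₀ * PiT) ≤ 1 / (2 * π) * (C₀ * PiT) :=
      mul_le_mul_of_nonneg_right hqLo1 (mul_nonneg hC₀0 hPiT0)
    have h3 : q * Γ ≤ q * (∑ k ∈ range n, ∑ l ∈ range n, WeilCert3.gHat c k l * z k l +
        5 * L ^ 2 * (c.nuPrimeAbs : ℝ)) :=
      mul_le_mul_of_nonneg_left hC hq0
    have hqq : 0 ≤ q - qLo := by linarith [invTwoPiLo20_le_invTwoPiHi20]
    have h4 : (q - qLo) * C₀ * PiT ≤ (q - qLo) * C₀ * (7 * N2) :=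
      mul_le_mul_of_nonneg_left hPiTle (mul_nonneg hqq hC₀0)
    nlinarith
  -- combine A, B, C (the `log π` term is NOT traded for `logPiHi20` here)
  have hB' : (c.base.wL : ℝ) * N2 - 1 / (2 * π) * Γ ≤ 1 / (2 * π) * A := by
    calc (c.base.wL : ℝ) * N2 - 1 / (2 * π) * Γ
        = 1 / (2 * π) * ((c.base.wL : ℝ) * (2 * π * N2) - Γ) := by field_simp
      _ ≤ 1 / (2 * π) * A := mul_le_mul_of_nonneg_left hB hpi.le
  have step1 : ∑ k ∈ range n, ∑ l ∈ range n,
      ((if k % 2 = l % 2 then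
        (-1 : ℝ) ^ k * 2 * ((a / 2) ^ k / k.factorial) * ((a / 2) ^ l / l.factorial) else 0) -
        q * WeilCert3.gHat c k l) * z k l +
      ((c.base.wL : ℝ) - (logPiHi20 : ℚ) - 7 * (q - qLo) * C₀) * N2 -
      ((8 * ρ + 6 * ρ ^ 2) + 5 * q * (c.nuPrimeAbs : ℝ)) * L ^ 2 ≤
        P - ((logPiHi20 : ℚ) : ℝ) * N2 + 1 / (2 * π) * A := by
    have e1 : ∑ k ∈ range n, ∑ l ∈ range n,
        ((if k % 2 = l % 2 then
          (-1 : ℝ) ^ k * 2 * ((a / 2) ^ k / k.factorial) * ((a / 2) ^ l / l.factorial) else 0) -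
          q * WeilCert3.gHat c k l) * z k l =
        ∑ k ∈ range n, ∑ l ∈ range n,
          (if k % 2 = l % 2 then
            (-1 : ℝ) ^ k * 2 * ((a / 2) ^ k / k.factorial) * ((a / 2) ^ l / l.factorial) else 0) *
              z k l -
        q * ∑ k ∈ range n, ∑ l ∈ range n, WeilCert3.gHat c k l * z k l := by
      rw [Finset.mul_sum, ← Finset.sum_sub_distrib]
      refine Finset.sum_congr rfl fun k _ ↦ ?_
      rw [Finset.mul_sum, ← Finset.sum_sub_distrib]
      refine Finset.sum_congr rfl fun l _ ↦ ?_
      ring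
    rw [e1]
    linarith [hPA, hB', hΓlow]
  -- rounding of the matrix and of the moment table, together: `|prQ − Pexact| ≤ δ`
  have hMk : ∀ k, ‖M k‖ ≤ L := fun k ↦ norm_weilMoment_le hg ha hsupp' k
  set q6 : ℝ := ((invTwoPiHi : ℚ) : ℝ) with hq6
  have hq60 : 0 ≤ q6 := invTwoPiHi_nonneg
  set δ : ℝ := 1 / 2 ^ c.base.pg + q6 * (1 / 2 ^ c.pnu) with hδ
  have hδ0 : 0 ≤ δ := by rw [hδ]; positivity
  have hround : ∑ k ∈ range n, ∑ l ∈ range n, ((c.base.prQ nu k l : ℚ) : ℝ) * z k l -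
      ∑ k ∈ range n, ∑ l ∈ range n,
        ((if k % 2 = l % 2 then
          (-1 : ℝ) ^ k * 2 * ((a / 2) ^ k / k.factorial) * ((a / 2) ^ l / l.factorial) else 0) -
          q * WeilCert3.gHat c k l) * z k l ≤ δ * (n : ℝ) ^ 2 * L ^ 2 := by
    refine WeilCert3.quad_rounding_le' n (fun k l ↦ ((c.base.prQ nu k l : ℚ) : ℝ)) _ δ L hδ0
      (fun k hk l hl ↦ ?_) M hMk
    have h1 : |((c.base.prQ nu k l : ℚ) : ℝ) - ((c.base.pmQ nu k l : ℚ) : ℝ)| ≤ 1 / 2 ^ c.base.pg := by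
      rw [abs_sub_comm]
      unfold WeilCert.prQ
      exact abs_cast_sub_ratRd_le c.base.pg (c.base.pmQ nu k l)
    have h2q := WeilCert3.abs_pmQ_sub_pmQexact_le hnuchk (by omega : k < c.base.N + 1)
      (by omega : l < c.base.N + 1)
    have h2 : |((c.base.pmQ nu k l : ℚ) : ℝ) - ((WeilCert3.pmQexact c k l : ℚ) : ℝ)| ≤
        q6 * (1 / 2 ^ c.pnu) := by
      have h := (Rat.cast_le (K := ℝ)).2 h2q
      rw [hnu, hq6]
      push_cast at h ⊢
      exact h
    have h3 : ((WeilCert3.pmQexact c k l : ℚ) : ℝ) =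
        (if k % 2 = l % 2 then
          (-1 : ℝ) ^ k * 2 * ((a / 2) ^ k / k.factorial) * ((a / 2) ^ l / l.factorial) else 0) -
          q * WeilCert3.gHat c k l := by
      rw [WeilCert3.pmQexact_cast, ha_def, hq]
    rw [hδ, ← h3]
    exact (abs_sub_le _ _ _).trans (add_le_add h1 h2)
  -- κ_exact
  have hcoef : 0 ≤ (8 * ρ + 6 * ρ ^ 2) + 5 * q * (c.nuPrimeAbs : ℝ) + δ * (n : ℝ) ^ 2 :=
    add_nonneg (add_nonneg (by positivity) (mul_nonneg (mul_nonneg (by norm_num) hq0) hν0))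
      (by positivity)
  have hkex : ((c.kappaExact : ℚ) : ℝ) =
      ((c.base.wL : ℝ) - (logPiHi20 : ℚ) - 7 * (q - qLo) * C₀) -
        2 * a * ((8 * ρ + 6 * ρ ^ 2) + 5 * q * (c.nuPrimeAbs : ℝ) + δ * (n : ℝ) ^ 2) := by
    rw [hρ, hq, hqLo, hC₀, hn, ha_def, hδ, hq6]
    unfold WeilCert3.kappaExact WeilCert.etaP WeilCert.rhoE
    push_cast
    ring
  have hκle : ((c.kappaQ : ℚ) : ℝ) ≤ ((c.kappaExact : ℚ) : ℝ) := by
    unfold WeilCert3.kappaQ; exact_mod_cast ratRd_le c.base.pg _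
  have hκ0 : (0 : ℝ) ≤ ((c.kappaQ : ℚ) : ℝ) := by exact_mod_cast hκ
  -- E + (log π − logPiHi20) N2 ≥ Σ pr z + κ N2
  have step3 : ∑ k ∈ range n, ∑ l ∈ range n, ((c.base.prQ nu k l : ℚ) : ℝ) * z k l +
      ((c.kappaQ : ℚ) : ℝ) * N2 ≤ P - ((logPiHi20 : ℚ) : ℝ) * N2 + 1 / (2 * π) * A := by
    have h1 : ((c.kappaQ : ℚ) : ℝ) * N2 ≤ ((c.kappaExact : ℚ) : ℝ) * N2 :=
      mul_le_mul_of_nonneg_right hκle hN20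
    rw [hkex] at h1
    have h2 := mul_le_mul_of_nonneg_left hL1 hcoef
    linarith [step1, hround, h1, h2]
  -- Bessel and the algebraic core
  have hbes : 2 * (∑ k ∈ range n, conj (c.base.uVec M k) * M k).re -
      (∑ k ∈ range n, ∑ l ∈ range n,
        conj (c.base.uVec M k) * c.base.uVec M l * (gramH a k l : ℂ)).re ≤ N2 :=
    weilNorm2Sq_ge_bessel hg ha hsupp' n (c.base.uVec M)
  have hcore : 0 ≤ (∑ k ∈ range n, ∑ l ∈ range n, ((c.base.prQ nu k l : ℚ) : ℝ) * z k l) +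
      ((c.kappaQ : ℚ) : ℝ) *
        (2 * (∑ k ∈ range n, conj (c.base.uVec M k) * M k).re -
          (∑ k ∈ range n, ∑ l ∈ range n,
            conj (c.base.uVec M k) * c.base.uVec M l * (gramH a k l : ℂ)).re) := by
    have := WeilCert.core_nonnegK (c := c.base) (nu := nu) (κ := c.kappaQ) hN hb0 hb1 a ha_def.symm M
    rw [← hn] at this
    exact this
  have h4 := mul_le_mul_of_nonneg_left hbes hκ0
  linarith [step3, h4, hcore]

/-- **Margin form of first-prime Weil positivity on `C((log 3)/2)`**: for every test function `g`
with `tsupport g ⊆ [-(log 3)/2, (log 3)/2]`, `(logPiHi20 − log π) ∫ |g|² ≤ Re Q(g)`, with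
`logPiHi20 − log π > 0` (the margin the kernel certificate `weilCert3C` carries; `Re Q = E₂` there,
`weilQuadratic_re_eq_weilFirstPrimeQuadratic`). [folklore] -/
theorem weilQuadratic_re_ge_margin_log_three_half {g : ℝ → ℂ} (hg : IsWeilTest g)
    (hsupp : tsupport g ⊆ Icc (-(Real.log 3 / 2)) (Real.log 3 / 2)) :
    (((logPiHi20 : ℚ) : ℝ) - Real.log π) * ∫ t : ℝ, ‖g t‖ ^ 2 ≤ (weilQuadratic g).re := by
  rw [weilQuadratic_re_eq_weilFirstPrimeQuadratic hg hsupp]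
  have hb : tsupport g ⊆ Icc (-((weilCert3C.b : ℚ) : ℝ)) ((weilCert3C.b : ℚ) : ℝ) :=
    hsupp.trans (Icc_subset_Icc (by linarith [log_three_half_le_certb]) log_three_half_le_certb)
  exact weilFirstPrimeQuadratic_margin_of_check check_weilCert3C hg hb

/-! ## `0 < ε((log 3)/2)` and consequences -/

/-- **Yoshida's first rung is strictly regular: `0 < ε((log 3)/2)`** (`ε = weilGroundEnergy`). Every
value `Re Q(g)` on the unit `L²`-sphere of test functions supported in `[-(log 3)/2, (log 3)/2]` is
`≥ δ := logPiHi20 − log π` (`weilQuadratic_re_ge_margin_log_three_half`), `δ > 0` since `π < piHi20`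
(`lt_piHi20`) strictly, the sphere is nonempty
(`exists_isWeilTest_sphere`), hence `ε((log 3)/2) = sInf {…} ≥ δ > 0`. In particular `(log 3)/2` is
not a conjugate point of Weil's form. [folklore] -/
theorem weilGroundEnergy_log_three_half_pos :
    0 < Literature.NumberTheory.LFunctions.weilGroundEnergy (Real.log 3 / 2) := by
  unfold weilGroundEnergy
  -- `log π < logPiHi20` STRICTLY: `π < piHi20` (`lt_piHi20`), then the chain of `logPiHi20_ge`
  have hδ : 0 < ((logPiHi20 : ℚ) : ℝ) - Real.log π := by
    have hy0 : (0 : ℚ) ≤ piOverThreeSubOne := by unfold piOverThreeSubOne piHi20; norm_num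
    have hy1 : piOverThreeSubOne < (1 : ℚ) := by unfold piOverThreeSubOne piHi20; norm_num
    have h1 : Real.log π < Real.log ((piHi20 : ℚ) : ℝ) := Real.log_lt_log Real.pi_pos lt_piHi20
    have h2 : Real.log ((piHi20 : ℚ) : ℝ) =
        Real.log 3 + Real.log (1 + ((piOverThreeSubOne : ℚ) : ℝ)) := by
      rw [← Real.log_mul (by norm_num) (by unfold piOverThreeSubOne piHi20; norm_num)]
      congr 1
      unfold piOverThreeSubOne
      push_cast
      ring
    have h3 := log_one_add_le_logOnePlusHiQ hy0 hy1 8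
    have h4 := logThree_le
    rw [sub_pos]
    unfold logPiHi20
    push_cast
    linarith
  have ha : 0 < Real.log 3 / 2 := by
    have := Real.log_pos (by norm_num : (1 : ℝ) < 3)
    positivity
  obtain ⟨g₀, hg₀, hsupp₀, hnorm₀⟩ := exists_isWeilTest_sphere ha
  refine lt_of_lt_of_le hδ (le_csInf ⟨_, g₀, hg₀, hsupp₀, hnorm₀, rfl⟩ ?_)
  rintro x ⟨g, hg, hsupp, hnorm, rfl⟩
  have h := weilQuadratic_re_ge_margin_log_three_half hg hsupp
  rwa [hnorm, mul_one] at h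

/-- `0 < ε(a)` for every `0 < a ≤ (log 3)/2` (strict antitonicity below the rung,
`weilGroundEnergy_lt_of_lt`). [folklore] -/
theorem weilGroundEnergy_pos_of_le_log_three_half {a : ℝ} (ha : 0 < a) (h : a ≤ Real.log 3 / 2) :
    0 < weilGroundEnergy a := by
  rcases h.lt_or_eq with hlt | heq
  · exact weilGroundEnergy_log_three_half_pos.trans (weilGroundEnergy_lt_of_lt ha hlt)
  · rw [heq]; exact weilGroundEnergy_log_three_half_pos

/-- **A conjugate point lies strictly above Yoshida's rung**: `ε(a⋆) = 0`, `a⋆ > 0` give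
`(log 3)/2 < a⋆`. [folklore] -/
theorem log_three_half_lt_of_conjugatePoint {a : ℝ} (ha : 0 < a) (h0 : weilGroundEnergy a = 0) :
    Real.log 3 / 2 < a := by
  by_contra hle
  have := weilGroundEnergy_pos_of_le_log_three_half ha (le_of_not_gt hle)
  linarith

/-- **Weil positivity past Yoshida's rung: a window containing the primes `2` and `3`.** There is
`a > (log 3)/2` with `WeilPositivityOn a` — `Re W(g ⋆ g̃) ≥ 0` for every test `g` supported in
`[-a, a]`, where now BOTH prime spikes `log 2, log 3 ∈ (-2a, 2a)` enter the explicit formula.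
Strict positivity at the rung (`weilGroundEnergy_log_three_half_pos`) persists to the right by
continuity of `ε` (`continuousAt_weilGroundEnergy`, Suzuki/Bombieri), and `0 ≤ ε x` is Weil positivity
on `[-x, x]` (`weilGroundEnergy_nonneg_iff_holds`). The window is ineffective. [folklore] -/
theorem exists_weilPositivityOn_gt_log_three_half :
    ∃ a : ℝ, Real.log 3 / 2 < a ∧ WeilPositivityOn a := by
  have ha₀ : 0 < Real.log 3 / 2 := by
    have := Real.log_pos (by norm_num : (1 : ℝ) < 3)
    positivity
  have hpos : 0 < weilGroundEnergy (Real.log 3 / 2) := weilGroundEnergy_log_three_half_pos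
  have hcont : ContinuousAt weilGroundEnergy (Real.log 3 / 2) := continuousAt_weilGroundEnergy ha₀
  have hev : ∀ᶠ x in 𝓝 (Real.log 3 / 2), 0 < weilGroundEnergy x :=
    hcont.eventually (lt_mem_nhds hpos)
  have hev' : ∀ᶠ x in 𝓝[>] (Real.log 3 / 2), 0 < weilGroundEnergy x ∧ Real.log 3 / 2 < x :=
    (hev.filter_mono nhdsWithin_le_nhds).and self_mem_nhdsWithin
  obtain ⟨x, hx, hxa⟩ := hev'.exists
  exact ⟨x, hxa, (weilGroundEnergy_nonneg_iff_holds (ha₀.trans hxa)).1 hx.le⟩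

/-- **Strict positivity slightly past the rung**: there is `a₁ > (log 3)/2` with `0 < ε(a)` for every
`0 < a < a₁` (so the conjugate point, if any, is `≥ a₁`). [folklore] -/
theorem exists_gt_log_three_half_weilGroundEnergy_pos :
    ∃ a₁ : ℝ, Real.log 3 / 2 < a₁ ∧ ∀ a : ℝ, 0 < a → a < a₁ → 0 < weilGroundEnergy a := by
  obtain ⟨a₁, ha₁, hpos⟩ := exists_weilPositivityOn_gt_log_three_half
  exact ⟨a₁, ha₁, fun a ha hlt => weilGroundEnergy_pos_of_weilPositivityOn_of_lt hpos ha hlt⟩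

/-- **For the line `conjugate-point`: the interior child gives the sibling crux with no side
condition.** If every level `B ≥ log 2` with a regular half level is a rung from the seed
(`CrystRegular`, child 1 of the prepared split of `WindowStep`), then the seed `WindowTraceArch`
gives `WindowTracePrime2` — because `(log 3)/2` IS regular (`weilGroundEnergy_log_three_half_pos`).
(The skeleton's `windowTracePrime2_of_crystRegular` carried `0 < ε((log 3)/2)` as a hypothesis.)
[folklore] -/
theorem windowTracePrime2_of_crystRegular_of_windowTraceArch
    (hR : ∀ B : ℝ, Real.log 2 ≤ B →
      Summit.RiemannHypothesis.RiemannHypothesis.Theses.SpectralTrace.WindowTraceArch →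
        0 < Literature.NumberTheory.LFunctions.weilGroundEnergy (B / 2) →
          ∃ (ι : Type) (γ : ι → ℝ), ∀ g : ℝ → ℂ, Literature.NumberTheory.LFunctions.IsWeilTest g →
            tsupport g ⊆ Set.Icc (-B) B →
              HasSum (fun i => Literature.NumberTheory.LFunctions.weilMellin g (1 / 2 + (γ i : ℂ) * Complex.I))
                (Literature.NumberTheory.LFunctions.weilFunctional g))
    (hArch : Summit.RiemannHypothesis.RiemannHypothesis.Theses.SpectralTrace.WindowTraceArch) :
    Summit.RiemannHypothesis.RiemannHypothesis.Theses.SpectralTrace.WindowTracePrime2 :=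
  hR (Real.log 3) (Real.log_le_log two_pos (by norm_num)) hArch weilGroundEnergy_log_three_half_pos

end Summit.RiemannHypothesis.RiemannHypothesis.Theorems.SpectralTraceWindowStep

end
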